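/-
Copyright (c) 2026 the pub-hodgecm-mathlib formalisation cell (harness21).  Prover seat hodgecm-mathlib-K2E3-p24 (g0), HCML Track B «K2-LIT» ∕ h413
(`stmt-HodgeConjecture-24833`), line `K2_E3_EllipticInputs`, road «GL₂-sc» (road owner K2E5-p17 (g5), dealer K2E3-plan (g4)), NON-ELLIPTIC half (lead K2E3-p23 (g6)),
brick 2N-6, FILE 2 OF 4: Harish-Chandra's Theorem 15 for the SPLIT Cartan of `GL₂`, on the Lie algebra `𝔤𝔩₂(F)`, WITHOUT an additive character —
«`1[disc χ_X ≠ 0, χ_X has 2 roots in F] · ‖disc χ_X‖_F^{-(1/2+ε)} ∈ L¹_loc(𝔤𝔩₂(F))` for `ε < 1/2`», read off the ψ-free Borel-slice identity ★ (C).  2026-09-04.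
-/
import Summits.HodgeConjecture.HodgeConjecture.Theorems.K2E3GL2SplitDiscriminantBoxIntegral   -- ★ part 1 (this seat): `𝔤′ = (disc χ)⁻¹(Fˣ²)` and its openness, the box of a compact set, the box integral; brings ★ (C) `K2E3GL2BorelSliceKIntegral`
import HarnessLib

/-!
# K2_E3 road (h413), road «GL₂-sc», brick 2N-6 (2∕4) — T15, split half at `N = 2`, ψ-free: `X ↦ 1_{𝔤′}(X) ‖disc χ_X‖_F^{-(1/2+ε)}` is locally integrable on `𝔤𝔩₂(F)`

Cell `pub/hodgecm-mathlib` (D-0151), Track B, seat K2E3-p24 (g0) (hand on the NON-ELLIPTIC half of road «GL₂-sc», brick 2N-6 by name, K2E3-p23 (g6) 09:17:50Z ∕ K2E5-p17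
(g5) HANDS PROTOCOL).  `--supports stmt-HodgeConjecture-24833 --as helper`; THEOREMS ONLY (no definition ∕ instance ∕ notation ∕ named fact ∕ `sorry`); never imports
`Cruxes/…/Lines`.  COUNT-NEUTRAL.

WHY THIS FILE.  The `N = 2` twin of the road's T15 input was planned over ★ `K2E3GL2DiscrRpowNegLocallyIntegrable.locallyIntegrable_normAbs_discr_rpow_neg`, which is
proved by Fourier analysis and therefore carries a continuous non-trivial additive character `ψ` of `F` as a hypothesis; the interface `hNE₂` of the road has no
such letter and the tree has no existence theorem for `ψ` on a general local field.  This file proves the SPLIT part of Theorem 15 (all that the non-elliptic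
weight needs at `N = 2`: non-elliptic = split, there is no mixed Cartan) WITHOUT `ψ`, exactly as the `N = 3` split half ★ `K2E3GL3SplitDiscriminantLocIntegrable`
(K2E3-p17 (g7)) does, from the ψ-free Borel-slice identity ★ (C) `K2E3GL2BorelSliceKIntegral.lintegral_glInt_sliceFunctional_eq`:
`∫_K ∫_{F³} g(k b(r) k⁻¹) dr dk = c · ∫_{F⁴} 1[disc ∈ (Fˣ)²] (√‖disc‖)⁻¹ g ∘ chart` for every measurable `g ≥ 0`.  With `g = 1_S · ‖disc χ‖^{-ε}` the right-hand side is
`(c∕a) ∫_S 1_{𝔤′} ‖disc χ‖^{-(1/2+ε)} dμ𝔤` (`𝔤′ = (disc χ)⁻¹(Fˣ²)` by ★ part 1; chart measure `= a⁻¹ μ𝔤` by Haar uniqueness, ★ `isAddHaarMeasure_map_chart`) and the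
left-hand side is at most `κ(K) · I(2ε) · dx(𝔭^{-m})²` (`disc χ_{b(r)} = (r₀ − r₂)²`, `k b(r) k⁻¹ ∈ S` boxes `r`, ★ part 1); hence
**`setLIntegral_indicator_split_rpow_neg_lt_top`**: `∫_S 1_{𝔤′} ‖disc χ‖^{-(1/2+ε)} dμ𝔤 < ∞` for compact `S` and `ε < 1/2`, and
**`locallyIntegrable_indicator_split_rpow_neg`**: `X ↦ 1_{𝔤′}(X) ‖disc χ_X‖^{-(1/2+ε)}` is locally integrable for every additive Haar measure `μ𝔤` of `𝔤𝔩₂(F)`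
(`ε < 1/2`; the `N = 3` twin needs `ε < 1/4` because of the triple collision of roots).
[HarishChandra1970, Part V §6 Thm. 15 p. 63, Part VII §3 pp. 71–73] [HarishChandra1999AdmissibleDistributions, Thm. 4.4, Thm. 7.7, Lemma 7.9, §15] [WeilBNT1967, Ch. I §2–§4]
HONEST LABEL: HC_CM is proved only modulo the 7 printed citations (2 remaining named inputs: hLiu418 = stmt-HodgeConjecture-24832, h413 = stmt-HodgeConjecture-24833)
until rung 0 closes; count-neutral helper.

## Mathlib ∕ tree search
Tree: ★ (C) `K2E3GL2BorelSliceKIntegral.lintegral_glInt_sliceFunctional_eq`, ★ `K2E3GL2RegularNilpotentFourierLineInversion.{isAddHaarMeasure_map_chart, continuous_chart}`,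
★ part 1 `K2E3GL2SplitDiscriminantBoxIntegral.{discr_charpoly_borelSlice, setOf_discr_ne_zero_and_card_roots_eq_two_eq, isOpen_setOf_charpoly_discr_ne_zero_and_card_roots_eq_two,
exists_forall_conj_borelSlice_mem_imp, lintegral_pi_three_box_normAbs_sub_rpow_neg_lt_top}`, ★ `isOpen_setOf_isSquare_and_ne_zero`, ★ `continuous_discr_charpoly`,
★ `measurable_normAbs`, ★ `isCompact_glInt`, ★ `isOpen_glInt`.  Mathlib: `Matrix.charpoly_units_conj`, `Measure.isAddLeftInvariant_eq_smul`, `ENNReal.rpow_add`, `locallyIntegrable_iff`.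
Dedup: `rg "split_rpow_neg|SplitDiscriminantLocIntegrable"` over Literature∕Summits — only the `Fin 3` twin ★ `K2E3GL3SplitDiscriminantLocIntegrable`.

## References
* [HarishChandra1970] Harish-Chandra (van Dijk), *Harmonic Analysis on Reductive p-adic Groups*, LNM 162 (1970), Part V §6 Thm. 15, Part VII §3.
* [HarishChandra1999AdmissibleDistributions] Harish-Chandra (DeBacker–Sally), *Admissible Invariant Distributions on Reductive p-adic Groups* (1999), Thm. 4.4, Thm. 7.7, Lemma 7.9, §15.
* [WeilBNT1967] A. Weil, *Basic Number Theory* (1967), Ch. I §2–§4.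
-/

set_option autoImplicit false
set_option linter.dupNamespace false

noncomputable section

open MeasureTheory MeasureTheory.Measure Set Matrix Topology Polynomial Filter
open scoped MatrixGroups NNReal ENNReal
open ValuativeRel
open Literature.NumberTheory.GaloisRepresentations Literature.NumberTheory.GaloisRepresentations.IsNonarchimedeanLocalField
open Literature.NumberTheory.Automorphic Literature.NumberTheory.Automorphic.LocalFieldHaar
open Summit.HodgeConjecture.HodgeConjecture.Cruxes.H413.K2E3LocalFieldSquaresHensel
open Summit.HodgeConjecture.HodgeConjecture.Cruxes.H413.K2E3GL2RegularNilpotentFourierLineInversion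
open Summit.HodgeConjecture.HodgeConjecture.Cruxes.H413.K2E3GL2BorelSliceKIntegral
open Summit.HodgeConjecture.HodgeConjecture.Cruxes.H413.K2E3NormalizedCharBddNearSemisimpleRegular
open Summit.HodgeConjecture.HodgeConjecture.Cruxes.H413.K2E3GL2SplitDiscriminantBoxIntegral

namespace Summit.HodgeConjecture.HodgeConjecture.Cruxes.H413.K2E3GL2SplitDiscriminantLocIntegrable

/-! ## §2  `1_{𝔤′} ‖disc χ‖^{-(1/2+ε)} ∈ L¹_loc(𝔤𝔩₂(F))` for `ε < 1/2`, without an additive character -/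

section Main

variable {F : Type*} [Field F] [ValuativeRel F] [TopologicalSpace F] [IsNonarchimedeanLocalField F]
variable [MeasurableSpace (Matrix (Fin 2) (Fin 2) F)] [BorelSpace (Matrix (Fin 2) (Fin 2) F)]

/-- **THE SPLIT-CLASS SINGULAR INTEGRAL IS LOCALLY FINITE** (`N = 2`, ψ-free): for `2 ≠ 0` in `F`, compact `S ⊆ 𝔤𝔩₂(F)` and `ε < 1/2`,
`∫_S 1_{𝔤′}(X) ‖disc χ_X‖_F^{-(1/2+ε)} dμ𝔤(X) < ∞` (`ℝ≥0∞` form; ★ (C) against `g = 1_S ‖disc χ‖^{-ε}`, the chart measure `= a⁻¹ μ𝔤`, the box of §1 and the box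
integral at `a = 2ε`). [cite: HarishChandra1970, Part V §6 Thm. 15 p. 63] [cite: HarishChandra1999AdmissibleDistributions, Thm. 7.7, Lemma 7.9, §15] -/
theorem setLIntegral_indicator_split_rpow_neg_lt_top (h2 : (2 : F) ≠ 0) (μ𝔤 : Measure (Matrix (Fin 2) (Fin 2) F)) [μ𝔤.IsAddHaarMeasure]
    {S : Set (Matrix (Fin 2) (Fin 2) F)} (hS : IsCompact S) {ε : ℝ} (hε : ε < 1 / 2) :
    ∫⁻ X in S, {Y : Matrix (Fin 2) (Fin 2) F | Y.charpoly.discr ≠ 0 ∧ Y.charpoly.roots.card = 2}.indicator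
        (fun Y => ((normAbs F Y.charpoly.discr : ℝ≥0∞)) ^ (-(1 / 2 + ε))) X ∂μ𝔤 < ∞ := by
  classical
  haveI : T2Space F := (isLocalField F).toT2Space
  haveI : LocallyCompactSpace F := (isLocalField F).toLocallyCompactSpace
  haveI : SecondCountableTopology F := secondCountableTopology_localField F
  haveI : IsTopologicalRing F := inferInstance
  letI : MeasurableSpace F := borel F
  haveI : BorelSpace F := ⟨rfl⟩
  letI : MeasurableSpace (GL (Fin 2) F) := borel (GL (Fin 2) F)
  haveI : BorelSpace (GL (Fin 2) F) := ⟨rfl⟩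
  haveI : T2Space (GL (Fin 2) F) := t2Space_generalLinearGroup F 2
  haveI : T2Space (Matrix (Fin 2) (Fin 2) F) := inferInstanceAs (T2Space (Fin 2 → Fin 2 → F))
  haveI : SecondCountableTopology (Matrix (Fin 2) (Fin 2) F) := inferInstanceAs (SecondCountableTopology (Fin 2 → Fin 2 → F))
  haveI : SecondCountableTopology (Matrix (Fin 2) (Fin 2) F)ᵐᵒᵖ := MulOpposite.opHomeomorph.symm.secondCountableTopology
  haveI : SecondCountableTopology (GL (Fin 2) F) := Units.isEmbedding_embedProduct.secondCountableTopology
  haveI : SecondCountableTopology ↥(glInt 2 F) := TopologicalSpace.Subtype.secondCountableTopology _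
  haveI : BorelSpace ↥(glInt 2 F) := Subtype.borelSpace _
  haveI : CompactSpace ↥(glInt 2 F) := isCompact_iff_compactSpace.1 (isCompact_glInt 2 F)
  haveI : LocallyCompactSpace (GL (Fin 2) F) := locallyCompactSpace_generalLinearGroup F 2
  haveI : LocallyCompactSpace ↥(glInt 2 F) := (isOpen_glInt 2 F).isOpenEmbedding_subtypeVal.locallyCompactSpace
  haveI : LocallyCompactSpace (Matrix (Fin 2) (Fin 2) F) := Pi.locallyCompactSpace_of_finite
  set κ : Measure ↥(glInt 2 F) := Measure.haar with hκ
  haveI : IsFiniteMeasure κ := CompactSpace.isFiniteMeasure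
  set dx : Measure F := Measure.addHaar with hdx
  haveI : SFinite dx := inferInstance
  obtain ⟨c, hc0, hct, hid⟩ := lintegral_glInt_sliceFunctional_eq dx h2 κ
  -- the chart measure is `a⁻¹ μ𝔤`
  set ν : Measure (Matrix (Fin 2) (Fin 2) F) :=
    Measure.map (fun x : Fin 4 → F => (!![x 1, x 2; x 0, x 3] : Matrix (Fin 2) (Fin 2) F)) (Measure.pi fun _ : Fin 4 => dx) with hν
  haveI : ν.IsAddHaarMeasure := isAddHaarMeasure_map_chart dx
  have huniq : μ𝔤 = μ𝔤.addHaarScalarFactor ν • ν := isAddLeftInvariant_eq_smul μ𝔤 ν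
  set a : ℝ≥0 := μ𝔤.addHaarScalarFactor ν with ha
  have hapos : 0 < a := addHaarScalarFactor_pos_of_isAddHaarMeasure μ𝔤 ν
  have hchart : ∀ G : Matrix (Fin 2) (Fin 2) F → ℝ≥0∞, Measurable G →
      ∫⁻ y : Fin 4 → F, G !![y 1, y 2; y 0, y 3] ∂(Measure.pi fun _ : Fin 4 => dx) = ((a⁻¹ : ℝ≥0) : ℝ≥0∞) * ∫⁻ X, G X ∂μ𝔤 := by
    intro G hG
    rw [← lintegral_map hG continuous_chart.measurable, ← hν]
    conv_rhs => rw [huniq]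
    rw [lintegral_smul_measure, ENNReal.smul_def, smul_eq_mul, ← mul_assoc, ← ENNReal.coe_mul, inv_mul_cancel₀ hapos.ne',
      ENNReal.coe_one, one_mul]
  -- abbreviations
  set 𝔤' : Set (Matrix (Fin 2) (Fin 2) F) := {Y : Matrix (Fin 2) (Fin 2) F | Y.charpoly.discr ≠ 0 ∧ Y.charpoly.roots.card = 2} with h𝔤'
  have h𝔤'm : MeasurableSet 𝔤' := (isOpen_setOf_charpoly_discr_ne_zero_and_card_roots_eq_two h2).measurableSet
  set Sq : Set F := {D : F | IsSquare D ∧ D ≠ 0} with hSq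
  have hSqm : MeasurableSet Sq := (isOpen_setOf_isSquare_and_ne_zero h2).measurableSet
  have hmem𝔤' : ∀ X : Matrix (Fin 2) (Fin 2) F, X ∈ 𝔤' ↔ X.charpoly.discr ∈ Sq := fun X => by
    rw [h𝔤', setOf_discr_ne_zero_and_card_roots_eq_two_eq h2]; rfl
  have hdiscm : Measurable fun Y : Matrix (Fin 2) (Fin 2) F => Y.charpoly.discr := (continuous_discr_charpoly (R := F) (n := Fin 2)).measurable
  have hnd : Measurable fun Y : Matrix (Fin 2) (Fin 2) F => ((normAbs F Y.charpoly.discr : ℝ≥0∞)) := (measurable_normAbs.comp hdiscm).coe_nnreal_ennreal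
  have hSm : MeasurableSet S := hS.isClosed.measurableSet
  have hwm : Measurable (Sq.indicator fun D : F => (((NNReal.sqrt (normAbs F D))⁻¹ : ℝ≥0) : ℝ≥0∞)) :=
    ((NNReal.continuous_sqrt.measurable.comp measurable_normAbs).inv.coe_nnreal_ennreal).indicator hSqm
  -- the test function `g = 1_S ‖disc χ‖^{-ε}` and the integrand `G = w(disc χ) · g`
  set g : Matrix (Fin 2) (Fin 2) F → ℝ≥0∞ := fun Y => S.indicator (fun Y => ((normAbs F Y.charpoly.discr : ℝ≥0∞)) ^ (-ε)) Y with hg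
  have hgapp : ∀ Y, g Y = S.indicator (fun Y => ((normAbs F Y.charpoly.discr : ℝ≥0∞)) ^ (-ε)) Y := fun _ => rfl
  have hgm : Measurable g := (hnd.pow_const _).indicator hSm
  set G : Matrix (Fin 2) (Fin 2) F → ℝ≥0∞ := fun Y => Sq.indicator (fun D : F => (((NNReal.sqrt (normAbs F D))⁻¹ : ℝ≥0) : ℝ≥0∞)) Y.charpoly.discr * g Y with hGdef
  have hGm : Measurable G := (hwm.comp hdiscm).mul hgm
  -- (i) the integral in question is `∫ G dμ𝔤`
  have hRHS : ∫⁻ X in S, 𝔤'.indicator (fun Y => ((normAbs F Y.charpoly.discr : ℝ≥0∞)) ^ (-(1 / 2 + ε))) X ∂μ𝔤 = ∫⁻ X, G X ∂μ𝔤 := by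
    rw [← lintegral_indicator hSm]
    refine lintegral_congr fun X => ?_
    simp only [hGdef, hgapp]
    by_cases hXS : X ∈ S
    · by_cases hX : X ∈ 𝔤'
      · have hXq : X.charpoly.discr ∈ Sq := (hmem𝔤' X).1 hX
        rw [indicator_of_mem hXS, indicator_of_mem hX, indicator_of_mem hXq, indicator_of_mem hXS]
        have ht : normAbs F X.charpoly.discr ≠ 0 := (map_ne_zero (normAbs F)).2 hX.1
        have hsq : NNReal.sqrt (normAbs F X.charpoly.discr) ≠ 0 := by rwa [ne_eq, NNReal.sqrt_eq_zero]
        rw [ENNReal.coe_inv hsq, NNReal.sqrt_eq_rpow, ENNReal.coe_rpow_of_nonneg _ (by norm_num : (0 : ℝ) ≤ 1 / 2), ← ENNReal.rpow_neg,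
          ← ENNReal.rpow_add _ _ (ENNReal.coe_ne_zero.2 ht) ENNReal.coe_ne_top]
        congr 1
        ring
      · have hXq : X.charpoly.discr ∉ Sq := fun h => hX ((hmem𝔤' X).2 h)
        rw [indicator_of_mem hXS, indicator_of_notMem hX, indicator_of_notMem hXq, zero_mul]
    · rw [indicator_of_notMem hXS, indicator_of_notMem hXS, mul_zero]
  rw [hRHS]
  -- (ii) the left-hand side of ★ (C) is bounded through the box
  obtain ⟨m, hm⟩ := exists_forall_conj_borelSlice_mem_imp (F := F) hS
  set B : Set F := primePowBall F (-(m : ℤ)) with hB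
  have hBm : MeasurableSet B := measurableSet_primePowBall _
  set Q : (Fin 3 → F) → ℝ≥0∞ := fun r => (B.indicator (1 : F → ℝ≥0∞) (r 0) * B.indicator (1 : F → ℝ≥0∞) (r 1) * B.indicator (1 : F → ℝ≥0∞) (r 2)) *
    ((normAbs F (r 0 - r 2) : ℝ≥0∞)) ^ (-(2 * ε)) with hQ
  have hpt : ∀ (k : ↥(glInt 2 F)) (r : Fin 3 → F),
      g (((k : GL (Fin 2) F) : Matrix (Fin 2) (Fin 2) F) * !![r 0, r 1; 0, r 2] * ((((k : GL (Fin 2) F))⁻¹ : GL (Fin 2) F) : Matrix (Fin 2) (Fin 2) F)) ≤ Q r := by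
    intro k r
    by_cases hkr : ((k : GL (Fin 2) F) : Matrix (Fin 2) (Fin 2) F) * !![r 0, r 1; 0, r 2] *
        ((((k : GL (Fin 2) F))⁻¹ : GL (Fin 2) F) : Matrix (Fin 2) (Fin 2) F) ∈ S
    · have hrB : ∀ i, r i ∈ B := fun i => hm k r hkr i
      rw [hgapp, indicator_of_mem hkr, Matrix.coe_units_inv, Matrix.charpoly_units_conj, discr_charpoly_borelSlice, map_pow, ENNReal.coe_pow, hQ]
      simp only [indicator_of_mem (hrB 0), indicator_of_mem (hrB 1), indicator_of_mem (hrB 2), Pi.one_apply, mul_one, one_mul]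
      rw [← ENNReal.rpow_two, ← ENNReal.rpow_mul]
      ring_nf
      exact le_rfl
    · rw [hgapp, indicator_of_notMem hkr]
      exact zero_le
  have hQm : Measurable Q := by
    have hind : Measurable (B.indicator (1 : F → ℝ≥0∞)) := measurable_one.indicator hBm
    exact (((hind.comp (measurable_pi_apply 0)).mul (hind.comp (measurable_pi_apply 1))).mul (hind.comp (measurable_pi_apply 2))).mul
      ((measurable_normAbs.comp ((measurable_pi_apply 0).sub (measurable_pi_apply 2))).coe_nnreal_ennreal.pow_const _)
  have hLHS : ∫⁻ k : ↥(glInt 2 F), ∫⁻ r : Fin 3 → F,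
      g (((k : GL (Fin 2) F) : Matrix (Fin 2) (Fin 2) F) * !![r 0, r 1; 0, r 2] * ((((k : GL (Fin 2) F))⁻¹ : GL (Fin 2) F) : Matrix (Fin 2) (Fin 2) F))
        ∂(Measure.pi fun _ : Fin 3 => dx) ∂κ ≤ (∫⁻ r : Fin 3 → F, Q r ∂(Measure.pi fun _ : Fin 3 => dx)) * κ univ := by
    calc ∫⁻ k : ↥(glInt 2 F), ∫⁻ r : Fin 3 → F,
          g (((k : GL (Fin 2) F) : Matrix (Fin 2) (Fin 2) F) * !![r 0, r 1; 0, r 2] * ((((k : GL (Fin 2) F))⁻¹ : GL (Fin 2) F) : Matrix (Fin 2) (Fin 2) F))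
            ∂(Measure.pi fun _ : Fin 3 => dx) ∂κ
        ≤ ∫⁻ _k : ↥(glInt 2 F), ∫⁻ r : Fin 3 → F, Q r ∂(Measure.pi fun _ : Fin 3 => dx) ∂κ := lintegral_mono fun k => lintegral_mono fun r => hpt k r
      _ = (∫⁻ r : Fin 3 → F, Q r ∂(Measure.pi fun _ : Fin 3 => dx)) * κ univ := lintegral_const _
  have hbox : ∫⁻ r : Fin 3 → F, Q r ∂(Measure.pi fun _ : Fin 3 => dx) < ∞ :=
    lintegral_pi_three_box_normAbs_sub_rpow_neg_lt_top dx (-(m : ℤ)) (a := 2 * ε) (by linarith)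
  -- (iii) assemble: `c · a⁻¹ · ∫ G dμ𝔤 = LHS < ∞`
  have hidG : ∫⁻ k : ↥(glInt 2 F), ∫⁻ r : Fin 3 → F,
      g (((k : GL (Fin 2) F) : Matrix (Fin 2) (Fin 2) F) * !![r 0, r 1; 0, r 2] * ((((k : GL (Fin 2) F))⁻¹ : GL (Fin 2) F) : Matrix (Fin 2) (Fin 2) F))
        ∂(Measure.pi fun _ : Fin 3 => dx) ∂κ = c * (((a⁻¹ : ℝ≥0) : ℝ≥0∞) * ∫⁻ X, G X ∂μ𝔤) := by
    rw [hid g hgm, hchart G hGm]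
  have hfin : c * (((a⁻¹ : ℝ≥0) : ℝ≥0∞) * ∫⁻ X, G X ∂μ𝔤) < ∞ := by
    rw [← hidG]
    exact hLHS.trans_lt (ENNReal.mul_lt_top hbox (measure_lt_top κ _))
  have hainv : ((a⁻¹ : ℝ≥0) : ℝ≥0∞) ≠ 0 := ENNReal.coe_ne_zero.2 (inv_ne_zero hapos.ne')
  exact ENNReal.lt_top_of_mul_ne_top_right (ENNReal.lt_top_of_mul_ne_top_right hfin.ne hc0).ne hainv

/-- **T15, SPLIT HALF AT `N = 2`, ψ-FREE (power form): `X ↦ 1[disc χ_X ≠ 0 ∧ χ_X has 2 roots in F] · ‖disc χ_X‖_F^{-(1/2+ε)}` IS LOCALLY INTEGRABLE ON `𝔤𝔩₂(F)`**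
for every real `ε < 1/2`, every additive Haar measure `μ𝔤`, and every non-archimedean local field `F` with `2 ≠ 0` (Harish-Chandra's Theorem 15 for the split Cartan
of `GL₂`, on the Lie algebra; at `N = 2` the non-elliptic regular set IS the split set).  No additive character and no characteristic-zero hypothesis is used.
[cite: HarishChandra1970, Part V §6 Thm. 15 p. 63, Part VII §3 pp. 71–73] [cite: HarishChandra1999AdmissibleDistributions, §15] -/
theorem locallyIntegrable_indicator_split_rpow_neg (h2 : (2 : F) ≠ 0) (μ𝔤 : Measure (Matrix (Fin 2) (Fin 2) F)) [μ𝔤.IsAddHaarMeasure]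
    {ε : ℝ} (hε : ε < 1 / 2) :
    LocallyIntegrable (fun X : Matrix (Fin 2) (Fin 2) F =>
      {Y : Matrix (Fin 2) (Fin 2) F | Y.charpoly.discr ≠ 0 ∧ Y.charpoly.roots.card = 2}.indicator
        (fun Y => ((normAbs F Y.charpoly.discr : ℝ)) ^ (-(1 / 2 + ε))) X) μ𝔤 := by
  haveI : T2Space F := (isLocalField F).toT2Space
  haveI : LocallyCompactSpace F := (isLocalField F).toLocallyCompactSpace
  haveI : IsTopologicalRing F := inferInstance
  haveI : T2Space (Matrix (Fin 2) (Fin 2) F) := inferInstanceAs (T2Space (Fin 2 → Fin 2 → F))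
  haveI : LocallyCompactSpace (Matrix (Fin 2) (Fin 2) F) := Pi.locallyCompactSpace_of_finite
  letI : MeasurableSpace F := borel F
  haveI : BorelSpace F := ⟨rfl⟩
  set 𝔤' : Set (Matrix (Fin 2) (Fin 2) F) := {Y : Matrix (Fin 2) (Fin 2) F | Y.charpoly.discr ≠ 0 ∧ Y.charpoly.roots.card = 2} with h𝔤'
  have h𝔤'm : MeasurableSet 𝔤' := (isOpen_setOf_charpoly_discr_ne_zero_and_card_roots_eq_two h2).measurableSet
  have hdiscm : Measurable fun Y : Matrix (Fin 2) (Fin 2) F => Y.charpoly.discr := (continuous_discr_charpoly (R := F) (n := Fin 2)).measurable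
  have hm : Measurable fun X : Matrix (Fin 2) (Fin 2) F => 𝔤'.indicator (fun Y => ((normAbs F Y.charpoly.discr : ℝ)) ^ (-(1 / 2 + ε))) X :=
    (((measurable_normAbs.comp hdiscm).coe_nnreal_real).pow_const _).indicator h𝔤'm
  refine (locallyIntegrable_iff).2 fun S hS => ⟨hm.aestronglyMeasurable, ?_⟩
  show ∫⁻ X in S, ‖𝔤'.indicator (fun Y => ((normAbs F Y.charpoly.discr : ℝ)) ^ (-(1 / 2 + ε))) X‖ₑ ∂μ𝔤 < ∞
  have hpt : ∀ X, ‖𝔤'.indicator (fun Y => ((normAbs F Y.charpoly.discr : ℝ)) ^ (-(1 / 2 + ε))) X‖ₑ =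
      𝔤'.indicator (fun Y => ((normAbs F Y.charpoly.discr : ℝ≥0∞)) ^ (-(1 / 2 + ε))) X := by
    intro X
    by_cases hX : X ∈ 𝔤'
    · rw [indicator_of_mem hX, indicator_of_mem hX]
      have ht : 0 < (normAbs F X.charpoly.discr : ℝ) := NNReal.coe_pos.2 (pos_iff_ne_zero.2 ((map_ne_zero (normAbs F)).2 hX.1))
      rw [Real.enorm_eq_ofReal (Real.rpow_nonneg ht.le _), ← ENNReal.ofReal_rpow_of_pos ht, ENNReal.ofReal_coe_nnreal]
    · rw [indicator_of_notMem hX, indicator_of_notMem hX, enorm_zero]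
  simp_rw [hpt]
  exact setLIntegral_indicator_split_rpow_neg_lt_top h2 μ𝔤 hS hε

end Main

end Summit.HodgeConjecture.HodgeConjecture.Cruxes.H413.K2E3GL2SplitDiscriminantLocIntegrable

end
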